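import Summits.QuantumFields.YangMills.Theorems.IR.FlatConnectionPropagation
import HarnessLib

/-!
# Flat lattice gauge fields with an ABELIAN gauge group on the `Fin`-torus, II: the count `#Flat = |G|^{V+3}` (helper for stmt-QuantumFields-26930)

Sequel of `Theorems/IR/FlatConnectionPropagation.lean` (p784028) and `Theorems/IR/ColdDefectFreezingLimit.lean` (p783777); LEAD prover
`ymfull-r2c-lead-1` g0, cell `ym-gapexp`, `--supports stmt-QuantumFields-26930`.  For a FINITE ABELIAN gauge group `G` the flat gauge fields
(all plaquette holonomies trivial) on the `Fin`-torus with `V` sites are counted exactly: `#Flat = |G|^{V+3}` (`card_flat`) — gauge orbits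
(`|G|^{V−1}`) times 't Hooft's flux sectors `Hom(ℤ⁴, G) ≅ G⁴`.  Proof: the gauge × twist parametrisation
`(g, s) ↦ (x, μ) ↦ g(x)⁻¹ g(x + e_μ) · [s_μ on the μ-seam]` is a homomorphism `G^V × G⁴ → G^{links}` with image the flat fields
(⊆ telescoping; ⊇ subtract the comb path-ordered product and the base holonomies, then PROPAGATION `eq_one_of_flat_of_comb`) and kernel the
constants; first isomorphism theorem.  Consequence (sequel): the freezing limit of `coldDefect` is `1 − |G|⁻³` at every box for finite abelian `G`.
Def-free.  HONEST FRAMING: finite-group lattice combinatorics on the BC5 ∕ calibration side of the crux `IRcof`; nothing here proves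
`PinnedExitsCofinalAt`, `IRcof`, `IR`, or the Yang–Mills mass gap.  Reference: G. 't Hooft, Nucl. Phys. B153 (1979) 141, §§2–4.
-/

set_option autoImplicit false

open Literature.MathematicalPhysics.QuantumFieldTheory

namespace Summit.QuantumFields.YangMills.Cruxes.IR.FreezingLimit

variable {G : Type} [CommGroup G] {m₀ m₁ m₂ m₃ : ℕ}

/-! ## §1 Abelian plaquette algebra -/

/-- One gauge step along a path-ordered product: `(P·A)⁻¹ · (P·(x·A)) = x`. -/
theorem gauge_step (P A x : G) : (P * A)⁻¹ * (P * (x * A)) = x := by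
  rw [← div_eq_one, ← ofMul_eq_zero]; simp only [ofMul_mul, ofMul_inv, ofMul_div]; abel

/-- The plaquette holonomy is multiplicative in the field (abelian group). -/
theorem finTorusPlaquette_mul {n₀ n₁ n₂ n₃ : ℕ} (U V : FinTorusSite n₀ n₁ n₂ n₃ × Fin 4 → G) (x : FinTorusSite n₀ n₁ n₂ n₃)
    (μ ν : Fin 4) : finTorusPlaquette (U * V) x μ ν = finTorusPlaquette U x μ ν * finTorusPlaquette V x μ ν := by
  simp only [finTorusPlaquette, Pi.mul_apply]
  rw [← div_eq_one, ← ofMul_eq_zero]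
  simp only [ofMul_mul, ofMul_inv, ofMul_div]
  abel

/-- The plaquette holonomy of the inverse field is the inverse (abelian group). -/
theorem finTorusPlaquette_inv {n₀ n₁ n₂ n₃ : ℕ} (U : FinTorusSite n₀ n₁ n₂ n₃ × Fin 4 → G) (x : FinTorusSite n₀ n₁ n₂ n₃)
    (μ ν : Fin 4) : finTorusPlaquette U⁻¹ x μ ν = (finTorusPlaquette U x μ ν)⁻¹ := by
  simp only [finTorusPlaquette, Pi.inv_apply]
  rw [← div_eq_one, ← ofMul_eq_zero]
  simp only [ofMul_mul, ofMul_inv, ofMul_div]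
  abel

/-! ## §2 Pure gauges and seam twists are flat -/

/-- **Pure gauges are flat**: the field `(x, μ) ↦ g(x)⁻¹ g(x + e_μ)` has trivial plaquettes (telescoping around the square). -/
theorem flat_pureGauge (g : FinTorusSite (m₀ + 1) (m₁ + 1) (m₂ + 1) (m₃ + 1) → G)
    (x : FinTorusSite (m₀ + 1) (m₁ + 1) (m₂ + 1) (m₃ + 1)) (μ ν : Fin 4) :
    finTorusPlaquette (fun l : FinTorusSite (m₀ + 1) (m₁ + 1) (m₂ + 1) (m₃ + 1) × Fin 4 => (g l.1)⁻¹ * g (l.1.shift l.2)) x μ ν = 1 := by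
  obtain ⟨a, b, c, d⟩ := x
  fin_cases μ <;> fin_cases ν <;> simp [finTorusPlaquette]

/-- **Seam twists are flat**: the field carrying `s_μ` on the axis-`μ` links based at `x_μ = last` (and `1` elsewhere) has trivial plaquettes. -/
theorem flat_seamTwist (s : Fin 4 → G) (x : FinTorusSite (m₀ + 1) (m₁ + 1) (m₂ + 1) (m₃ + 1)) (μ ν : Fin 4) :
    finTorusPlaquette (fun l : FinTorusSite (m₀ + 1) (m₁ + 1) (m₂ + 1) (m₃ + 1) × Fin 4 =>
      (![Pi.mulSingle (M := fun _ => G) (Fin.last m₀) (s 0) l.1.1, Pi.mulSingle (M := fun _ => G) (Fin.last m₁) (s 1) l.1.2.1,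
        Pi.mulSingle (M := fun _ => G) (Fin.last m₂) (s 2) l.1.2.2.1,
        Pi.mulSingle (M := fun _ => G) (Fin.last m₃) (s 3) l.1.2.2.2] : Fin 4 → G) l.2) x μ ν = 1 := by
  obtain ⟨a, b, c, d⟩ := x
  fin_cases μ <;> fin_cases ν <;> simp [finTorusPlaquette]

/-- **The gauge × twist field is flat.** -/
theorem flat_gaugeTwist (g : FinTorusSite (m₀ + 1) (m₁ + 1) (m₂ + 1) (m₃ + 1) → G) (s : Fin 4 → G)
    (x : FinTorusSite (m₀ + 1) (m₁ + 1) (m₂ + 1) (m₃ + 1)) (μ ν : Fin 4) :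
    finTorusPlaquette (fun l : FinTorusSite (m₀ + 1) (m₁ + 1) (m₂ + 1) (m₃ + 1) × Fin 4 =>
      (g l.1)⁻¹ * g (l.1.shift l.2) *
      (![Pi.mulSingle (M := fun _ => G) (Fin.last m₀) (s 0) l.1.1, Pi.mulSingle (M := fun _ => G) (Fin.last m₁) (s 1) l.1.2.1,
        Pi.mulSingle (M := fun _ => G) (Fin.last m₂) (s 2) l.1.2.2.1,
        Pi.mulSingle (M := fun _ => G) (Fin.last m₃) (s 3) l.1.2.2.2] : Fin 4 → G) l.2) x μ ν = 1 := by
  have h := finTorusPlaquette_mul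
    (fun l : FinTorusSite (m₀ + 1) (m₁ + 1) (m₂ + 1) (m₃ + 1) × Fin 4 => (g l.1)⁻¹ * g (l.1.shift l.2))
    (fun l : FinTorusSite (m₀ + 1) (m₁ + 1) (m₂ + 1) (m₃ + 1) × Fin 4 =>
      (![Pi.mulSingle (M := fun _ => G) (Fin.last m₀) (s 0) l.1.1, Pi.mulSingle (M := fun _ => G) (Fin.last m₁) (s 1) l.1.2.1,
        Pi.mulSingle (M := fun _ => G) (Fin.last m₂) (s 2) l.1.2.2.1,
        Pi.mulSingle (M := fun _ => G) (Fin.last m₃) (s 3) l.1.2.2.2] : Fin 4 → G) l.2) x μ ν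
  rw [flat_pureGauge, flat_seamTwist, one_mul] at h
  exact h

/-! ## §3 The kernel of the parametrisation: constants and no twist -/

/-- **Kernel.**  If the gauge × twist field of `(g, s)` is trivial then `s = 1` and `g` is constant. -/
theorem gaugeTwist_eq_one (g : FinTorusSite (m₀ + 1) (m₁ + 1) (m₂ + 1) (m₃ + 1) → G) (s : Fin 4 → G)
    (h : ∀ (x : FinTorusSite (m₀ + 1) (m₁ + 1) (m₂ + 1) (m₃ + 1)) (μ : Fin 4),
      (g x)⁻¹ * g (x.shift μ) *
      (![Pi.mulSingle (M := fun _ => G) (Fin.last m₀) (s 0) x.1, Pi.mulSingle (M := fun _ => G) (Fin.last m₁) (s 1) x.2.1,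
        Pi.mulSingle (M := fun _ => G) (Fin.last m₂) (s 2) x.2.2.1,
        Pi.mulSingle (M := fun _ => G) (Fin.last m₃) (s 3) x.2.2.2] : Fin 4 → G) μ = 1) :
    s = 1 ∧ ∀ x, g x = g (0, 0, 0, 0) := by
  -- the four twists vanish: multiply the relation along the base line of each axis
  have hs0 : s 0 = 1 := by
    have key : ∏ i : Fin (m₀ + 1), ((g (i, (0 : Fin (m₁ + 1)), (0 : Fin (m₂ + 1)), (0 : Fin (m₃ + 1))))⁻¹ *
        g (i + 1, 0, 0, 0) * Pi.mulSingle (M := fun _ => G) (Fin.last m₀) (s 0) i) = 1 :=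
      Finset.prod_eq_one fun i _ => by simpa using h (i, 0, 0, 0) 0
    rw [Finset.prod_mul_distrib, Finset.prod_mul_distrib, Finset.prod_inv_distrib,
      Fintype.prod_equiv (Equiv.addRight 1) (fun i => g (i + 1, 0, 0, 0)) (fun i => g (i, 0, 0, 0)) fun i => rfl,
      inv_mul_cancel, one_mul] at key
    simpa using key
  have hs1 : s 1 = 1 := by
    have key : ∏ i : Fin (m₁ + 1), ((g ((0 : Fin (m₀ + 1)), i, (0 : Fin (m₂ + 1)), (0 : Fin (m₃ + 1))))⁻¹ *
        g (0, i + 1, 0, 0) * Pi.mulSingle (M := fun _ => G) (Fin.last m₁) (s 1) i) = 1 :=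
      Finset.prod_eq_one fun i _ => by simpa using h (0, i, 0, 0) 1
    rw [Finset.prod_mul_distrib, Finset.prod_mul_distrib, Finset.prod_inv_distrib,
      Fintype.prod_equiv (Equiv.addRight 1) (fun i => g (0, i + 1, 0, 0)) (fun i => g (0, i, 0, 0)) fun i => rfl,
      inv_mul_cancel, one_mul] at key
    simpa using key
  have hs2 : s 2 = 1 := by
    have key : ∏ i : Fin (m₂ + 1), ((g ((0 : Fin (m₀ + 1)), (0 : Fin (m₁ + 1)), i, (0 : Fin (m₃ + 1))))⁻¹ *
        g (0, 0, i + 1, 0) * Pi.mulSingle (M := fun _ => G) (Fin.last m₂) (s 2) i) = 1 :=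
      Finset.prod_eq_one fun i _ => by simpa using h (0, 0, i, 0) 2
    rw [Finset.prod_mul_distrib, Finset.prod_mul_distrib, Finset.prod_inv_distrib,
      Fintype.prod_equiv (Equiv.addRight 1) (fun i => g (0, 0, i + 1, 0)) (fun i => g (0, 0, i, 0)) fun i => rfl,
      inv_mul_cancel, one_mul] at key
    simpa using key
  have hs3 : s 3 = 1 := by
    have key : ∏ i : Fin (m₃ + 1), ((g ((0 : Fin (m₀ + 1)), (0 : Fin (m₁ + 1)), (0 : Fin (m₂ + 1)), i))⁻¹ *
        g (0, 0, 0, i + 1) * Pi.mulSingle (M := fun _ => G) (Fin.last m₃) (s 3) i) = 1 :=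
      Finset.prod_eq_one fun i _ => by simpa using h (0, 0, 0, i) 3
    rw [Finset.prod_mul_distrib, Finset.prod_mul_distrib, Finset.prod_inv_distrib,
      Fintype.prod_equiv (Equiv.addRight 1) (fun i => g (0, 0, 0, i + 1)) (fun i => g (0, 0, 0, i)) fun i => rfl,
      inv_mul_cancel, one_mul] at key
    simpa using key
  have hs : s = 1 := by
    funext μ; fin_cases μ
    · exact hs0
    · exact hs1
    · exact hs2
    · exact hs3
  subst hs
  refine ⟨rfl, ?_⟩
  -- with no twist, `g` is invariant under every unit shift, hence constant
  have hinv : ∀ (x : FinTorusSite (m₀ + 1) (m₁ + 1) (m₂ + 1) (m₃ + 1)) (μ : Fin 4), g (x.shift μ) = g x := by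
    intro x μ
    have hx := h x μ
    have ht : (![Pi.mulSingle (M := fun _ => G) (Fin.last m₀) ((1 : Fin 4 → G) 0) x.1,
        Pi.mulSingle (M := fun _ => G) (Fin.last m₁) ((1 : Fin 4 → G) 1) x.2.1,
        Pi.mulSingle (M := fun _ => G) (Fin.last m₂) ((1 : Fin 4 → G) 2) x.2.2.1,
        Pi.mulSingle (M := fun _ => G) (Fin.last m₃) ((1 : Fin 4 → G) 3) x.2.2.2] : Fin 4 → G) μ = 1 := by
      fin_cases μ <;> simp
    rw [ht, mul_one, inv_mul_eq_one] at hx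
    exact hx.symm
  intro x
  rw [indep₀ g (fun y => hinv y 0) x, indep₁ g (fun y => hinv y 1), indep₂ g (fun y => hinv y 2), indep₃ g (fun y => hinv y 3)]

/-! ## §4 Small `Fin` bookkeeping for path-ordered products -/

/-- `Iio 0 = ∅` in `Fin (m+1)`. -/ theorem Iio_zero_fin {m : ℕ} : Finset.Iio (0 : Fin (m + 1)) = ∅ := by ext i; simp

/-- `Iio (j+1) = insert j (Iio j)` in `Fin (m+1)` for `j ≠ last`. -/
theorem Iio_add_one_eq_insert {m : ℕ} (j : Fin (m + 1)) (hj : j ≠ Fin.last m) :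
    Finset.Iio (j + 1) = insert j (Finset.Iio j) := by
  ext i
  simp only [Finset.mem_Iio, Finset.mem_insert, Fin.lt_def, Fin.val_add_one_of_lt (lt_of_le_of_ne (Fin.le_last j) hj)]
  constructor
  · intro h
    rcases Nat.lt_succ_iff_lt_or_eq.1 h with h | h
    · exact Or.inr h
    · exact Or.inl (Fin.ext h)
  · rintro (rfl | h)
    · exact Nat.lt_succ_self _
    · exact Nat.lt_succ_of_lt h

/-- Gauge-step shape `A⁻¹ · (x · A) = x`. -/ theorem gauge_step' (A x : G) : A⁻¹ * (x * A) = x := by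
  rw [← div_eq_one, ← ofMul_eq_zero]
  simp only [ofMul_mul, ofMul_inv, ofMul_div]
  abel

/-- `![a,b,c,d] 0 = a`. -/ theorem vec4_zero {α : Type} (a b c d : α) : (![a, b, c, d] : Fin 4 → α) 0 = a := by simp

/-- `![a,b,c,d] 1 = b`. -/ theorem vec4_one {α : Type} (a b c d : α) : (![a, b, c, d] : Fin 4 → α) 1 = b := by simp

/-- `![a,b,c,d] 2 = c`. -/ theorem vec4_two {α : Type} (a b c d : α) : (![a, b, c, d] : Fin 4 → α) 2 = c := by simp

/-- `![a,b,c,d] 3 = d`. -/ theorem vec4_three {α : Type} (a b c d : α) : (![a, b, c, d] : Fin 4 → α) 3 = d := by simp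

/-! ## §5 Surjectivity: every flat field is a gauge × twist field -/

/-- **Every flat field is gauge × twist.**  For a flat `U` take `g` = the path-ordered product of `U` along the comb path from the origin
(axis `3`, then `2`, then `1`, then `0`) and `s_μ` = the holonomy of `U` around the base axis-`μ` loop; then `U · (gauge × twist)⁻¹` is flat and
trivial on the comb and the base seams, hence trivial by PROPAGATION (`eq_one_of_flat_of_comb`). -/
theorem exists_gaugeTwist_of_flat (U : FinTorusSite (m₀ + 1) (m₁ + 1) (m₂ + 1) (m₃ + 1) × Fin 4 → G)
    (hflat : ∀ x μ ν, finTorusPlaquette U x μ ν = 1) :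
    ∃ (g : FinTorusSite (m₀ + 1) (m₁ + 1) (m₂ + 1) (m₃ + 1) → G) (s : Fin 4 → G),
      (fun l : FinTorusSite (m₀ + 1) (m₁ + 1) (m₂ + 1) (m₃ + 1) × Fin 4 =>
        (g l.1)⁻¹ * g (l.1.shift l.2) *
        (![Pi.mulSingle (M := fun _ => G) (Fin.last m₀) (s 0) l.1.1, Pi.mulSingle (M := fun _ => G) (Fin.last m₁) (s 1) l.1.2.1,
          Pi.mulSingle (M := fun _ => G) (Fin.last m₂) (s 2) l.1.2.2.1,
          Pi.mulSingle (M := fun _ => G) (Fin.last m₃) (s 3) l.1.2.2.2] : Fin 4 → G) l.2) = U := by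
  classical
  -- the comb path-ordered product and the base holonomies
  set g : FinTorusSite (m₀ + 1) (m₁ + 1) (m₂ + 1) (m₃ + 1) → G := fun x =>
    (∏ i ∈ Finset.Iio x.2.2.2, U (((0 : Fin (m₀ + 1)), (0 : Fin (m₁ + 1)), (0 : Fin (m₂ + 1)), i), 3)) *
    (∏ i ∈ Finset.Iio x.2.2.1, U (((0 : Fin (m₀ + 1)), (0 : Fin (m₁ + 1)), i, x.2.2.2), 2)) *
    (∏ i ∈ Finset.Iio x.2.1, U (((0 : Fin (m₀ + 1)), i, x.2.2.1, x.2.2.2), 1)) *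
    (∏ i ∈ Finset.Iio x.1, U ((i, x.2.1, x.2.2.1, x.2.2.2), 0)) with hg
  set s : Fin 4 → G := ![(∏ i ∈ Finset.Iio (Fin.last m₀), U ((i, 0, 0, 0), 0)) * U ((Fin.last m₀, 0, 0, 0), 0),
      (∏ i ∈ Finset.Iio (Fin.last m₁), U ((0, i, 0, 0), 1)) * U ((0, Fin.last m₁, 0, 0), 1),
      (∏ i ∈ Finset.Iio (Fin.last m₂), U ((0, 0, i, 0), 2)) * U ((0, 0, Fin.last m₂, 0), 2),
      (∏ i ∈ Finset.Iio (Fin.last m₃), U ((0, 0, 0, i), 3)) * U ((0, 0, 0, Fin.last m₃), 3)] with hs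
  refine ⟨g, s, ?_⟩
  set Φ : FinTorusSite (m₀ + 1) (m₁ + 1) (m₂ + 1) (m₃ + 1) × Fin 4 → G :=
    fun l => (g l.1)⁻¹ * g (l.1.shift l.2) *
      (![Pi.mulSingle (M := fun _ => G) (Fin.last m₀) (s 0) l.1.1, Pi.mulSingle (M := fun _ => G) (Fin.last m₁) (s 1) l.1.2.1,
        Pi.mulSingle (M := fun _ => G) (Fin.last m₂) (s 2) l.1.2.2.1,
        Pi.mulSingle (M := fun _ => G) (Fin.last m₃) (s 3) l.1.2.2.2] : Fin 4 → G) l.2 with hΦ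
  -- tree links: the gauge part reproduces `U`
  have hT0 : ∀ (a : Fin (m₀ + 1)) (b : Fin (m₁ + 1)) (c : Fin (m₂ + 1)) (d : Fin (m₃ + 1)), a ≠ Fin.last m₀ →
      (g (a, b, c, d))⁻¹ * g (a + 1, b, c, d) = U ((a, b, c, d), 0) := by
    intro a b c d ha
    simp only [hg, Iio_add_one_eq_insert a ha, Finset.prod_insert (by simp : a ∉ Finset.Iio a)]
    exact gauge_step _ _ _
  have hT1 : ∀ (b : Fin (m₁ + 1)) (c : Fin (m₂ + 1)) (d : Fin (m₃ + 1)), b ≠ Fin.last m₁ →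
      (g (0, b, c, d))⁻¹ * g (0, b + 1, c, d) = U ((0, b, c, d), 1) := by
    intro b c d hb
    simp only [hg, Iio_zero_fin, Finset.prod_empty, mul_one, Iio_add_one_eq_insert b hb,
      Finset.prod_insert (by simp : b ∉ Finset.Iio b)]
    exact gauge_step _ _ _
  have hT2 : ∀ (c : Fin (m₂ + 1)) (d : Fin (m₃ + 1)), c ≠ Fin.last m₂ →
      (g (0, 0, c, d))⁻¹ * g (0, 0, c + 1, d) = U ((0, 0, c, d), 2) := by
    intro c d hc
    simp only [hg, Iio_zero_fin, Finset.prod_empty, mul_one, Iio_add_one_eq_insert c hc,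
      Finset.prod_insert (by simp : c ∉ Finset.Iio c)]
    exact gauge_step _ _ _
  have hT3 : ∀ (d : Fin (m₃ + 1)), d ≠ Fin.last m₃ →
      (g (0, 0, 0, d))⁻¹ * g (0, 0, 0, d + 1) = U ((0, 0, 0, d), 3) := by
    intro d hd
    simp only [hg, Iio_zero_fin, Finset.prod_empty, mul_one, Iio_add_one_eq_insert d hd,
      Finset.prod_insert (by simp : d ∉ Finset.Iio d)]
    exact gauge_step' _ _
  -- the origin value of `g` is `1`
  have hg0 : g (0, 0, 0, 0) = 1 := by
    simp only [hg, Iio_zero_fin, Finset.prod_empty, mul_one]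
  -- W := U · Φ⁻¹ is flat
  have hW : ∀ x μ ν, finTorusPlaquette (U * Φ⁻¹) x μ ν = 1 := by
    intro x μ ν
    rw [finTorusPlaquette_mul, finTorusPlaquette_inv, hflat, hΦ, flat_gaugeTwist g s x μ ν, inv_one, mul_one]
  -- and trivial on the comb and on the four base seams: it suffices to evaluate Φ there
  have hWl : ∀ l, Φ l = U l → (U * Φ⁻¹) l = 1 := fun l h => by simp [h]
  have key := eq_one_of_flat_of_comb (U * Φ⁻¹) hW
    (by
      rintro ⟨a, b, c, d⟩ ha
      refine hWl _ ?_
      simp only [hΦ, shift_zero_eq, vec4_zero, Pi.mulSingle_eq_of_ne (show a ≠ Fin.last m₀ from ha), mul_one]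
      exact hT0 a b c d ha)
    (by
      refine hWl _ ?_
      simp only [hΦ, shift_zero_eq, vec4_zero, Fin.last_add_one, Pi.mulSingle_eq_same, hg0, mul_one]
      simp only [hs, vec4_zero, hg, Iio_zero_fin, Finset.prod_empty, one_mul, mul_one]
      exact inv_mul_cancel_left _ _)
    (by
      rintro ⟨a, b, c, d⟩ ha hb
      simp only at ha; subst ha
      refine hWl _ ?_
      simp only [hΦ, shift_one_eq, vec4_one, Pi.mulSingle_eq_of_ne (show b ≠ Fin.last m₁ from hb), mul_one]
      exact hT1 b c d hb)
    (by
      refine hWl _ ?_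
      simp only [hΦ, shift_one_eq, vec4_one, Fin.last_add_one, Pi.mulSingle_eq_same, hg0, mul_one]
      simp only [hs, vec4_one, hg, Iio_zero_fin, Finset.prod_empty, one_mul, mul_one]
      exact inv_mul_cancel_left _ _)
    (by
      rintro ⟨a, b, c, d⟩ ha hb hc
      simp only at ha hb; subst ha; subst hb
      refine hWl _ ?_
      simp only [hΦ, shift_two_eq, vec4_two, Pi.mulSingle_eq_of_ne (show c ≠ Fin.last m₂ from hc), mul_one]
      exact hT2 c d hc)
    (by
      refine hWl _ ?_
      simp only [hΦ, shift_two_eq, vec4_two, Fin.last_add_one, Pi.mulSingle_eq_same, hg0, mul_one]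
      simp only [hs, vec4_two, hg, Iio_zero_fin, Finset.prod_empty, one_mul, mul_one]
      exact inv_mul_cancel_left _ _)
    (by
      rintro ⟨a, b, c, d⟩ ha hb hc hd
      simp only at ha hb hc; subst ha; subst hb; subst hc
      refine hWl _ ?_
      simp only [hΦ, shift_three_eq, vec4_three, Pi.mulSingle_eq_of_ne (show d ≠ Fin.last m₃ from hd), mul_one]
      exact hT3 d hd)
    (by
      refine hWl _ ?_
      simp only [hΦ, shift_three_eq, vec4_three, Fin.last_add_one, Pi.mulSingle_eq_same, hg0, mul_one]
      simp only [hs, vec4_three, hg, Iio_zero_fin, Finset.prod_empty, mul_one]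
      exact inv_mul_cancel_left _ _)
  -- conclude Φ = U
  exact (mul_inv_eq_one.1 key).symm

/-! ## §6 Flatness on the positively oriented plaquettes suffices (abelian group) -/

/-- Reversing the orientation inverts the plaquette holonomy (abelian group). -/
theorem finTorusPlaquette_swap {n₀ n₁ n₂ n₃ : ℕ} (U : FinTorusSite n₀ n₁ n₂ n₃ × Fin 4 → G) (x : FinTorusSite n₀ n₁ n₂ n₃)
    (μ ν : Fin 4) : finTorusPlaquette U x ν μ = (finTorusPlaquette U x μ ν)⁻¹ := by
  simp only [finTorusPlaquette]
  rw [← div_eq_one, ← ofMul_eq_zero]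
  simp only [ofMul_mul, ofMul_inv, ofMul_div]
  abel

/-- All plaquettes are trivial iff the positively oriented ones (`μ < ν`, the index set of Wilson's action) are. -/
theorem flat_iff_flat_lt {n₀ n₁ n₂ n₃ : ℕ} (U : FinTorusSite n₀ n₁ n₂ n₃ × Fin 4 → G) :
    (∀ x μ ν, finTorusPlaquette U x μ ν = 1) ↔
      ∀ (x : FinTorusSite n₀ n₁ n₂ n₃) (q : {q : Fin 4 × Fin 4 // q.1 < q.2}), finTorusPlaquette U x q.1.1 q.1.2 = 1 := by
  refine ⟨fun h x q => h x _ _, fun h x μ ν => ?_⟩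
  rcases lt_trichotomy μ ν with hlt | rfl | hgt
  · exact h x ⟨(μ, ν), hlt⟩
  · simp [finTorusPlaquette]
  · rw [finTorusPlaquette_swap, h x ⟨(ν, μ), hgt⟩, inv_one]

/-! ## §7 The count -/

/-- **`#Flat = |G|^{V+3}` for a finite abelian gauge group.**  On the `Fin`-torus `n₀ × n₁ × n₂ × n₃` (all sides `≥ 1`, `V = n₀n₁n₂n₃`
sites) the gauge fields with values in a finite abelian group `G` all of whose plaquette holonomies are trivial number exactly
`|G|^{V+3}`: the image of the gauge × twist homomorphism `G^V × G⁴ → G^{links}` (kernel = constants, `|G|`) is the set of flat fields. -/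
theorem card_flat [Finite G] {n₀ n₁ n₂ n₃ : ℕ} (h₀ : 0 < n₀) (h₁ : 0 < n₁) (h₂ : 0 < n₂) (h₃ : 0 < n₃) :
    Nat.card {U : FinTorusSite n₀ n₁ n₂ n₃ × Fin 4 → G // ∀ x μ ν, finTorusPlaquette U x μ ν = 1} =
      Nat.card G ^ (Nat.card (FinTorusSite n₀ n₁ n₂ n₃) + 3) := by
  classical
  obtain ⟨m₀, rfl⟩ := Nat.exists_eq_add_one_of_ne_zero h₀.ne'
  obtain ⟨m₁, rfl⟩ := Nat.exists_eq_add_one_of_ne_zero h₁.ne'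
  obtain ⟨m₂, rfl⟩ := Nat.exists_eq_add_one_of_ne_zero h₂.ne'
  obtain ⟨m₃, rfl⟩ := Nat.exists_eq_add_one_of_ne_zero h₃.ne'
  -- the gauge × twist homomorphism
  let Φ : ((FinTorusSite (m₀ + 1) (m₁ + 1) (m₂ + 1) (m₃ + 1) → G) × (Fin 4 → G)) →*
      (FinTorusSite (m₀ + 1) (m₁ + 1) (m₂ + 1) (m₃ + 1) × Fin 4 → G) :=
    { toFun := fun p l => (p.1 l.1)⁻¹ * p.1 (l.1.shift l.2) *
        (![Pi.mulSingle (M := fun _ => G) (Fin.last m₀) (p.2 0) l.1.1, Pi.mulSingle (M := fun _ => G) (Fin.last m₁) (p.2 1) l.1.2.1,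
          Pi.mulSingle (M := fun _ => G) (Fin.last m₂) (p.2 2) l.1.2.2.1,
          Pi.mulSingle (M := fun _ => G) (Fin.last m₃) (p.2 3) l.1.2.2.2] : Fin 4 → G) l.2
      map_one' := by
        funext l
        obtain ⟨x, μ⟩ := l
        fin_cases μ <;> simp
      map_mul' := by
        intro p q
        funext l
        obtain ⟨x, μ⟩ := l
        fin_cases μ <;> simp [Pi.mulSingle_mul] <;>
          (rw [← div_eq_one, ← ofMul_eq_zero]; simp only [ofMul_mul, ofMul_inv, ofMul_div]; abel) }
  have hΦ : ∀ (g : FinTorusSite (m₀ + 1) (m₁ + 1) (m₂ + 1) (m₃ + 1) → G) (s : Fin 4 → G),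
      Φ (g, s) = fun l => (g l.1)⁻¹ * g (l.1.shift l.2) *
        (![Pi.mulSingle (M := fun _ => G) (Fin.last m₀) (s 0) l.1.1, Pi.mulSingle (M := fun _ => G) (Fin.last m₁) (s 1) l.1.2.1,
          Pi.mulSingle (M := fun _ => G) (Fin.last m₂) (s 2) l.1.2.2.1,
          Pi.mulSingle (M := fun _ => G) (Fin.last m₃) (s 3) l.1.2.2.2] : Fin 4 → G) l.2 := fun _ _ => rfl
  -- its range is the set of flat fields
  have hrange : ∀ U : FinTorusSite (m₀ + 1) (m₁ + 1) (m₂ + 1) (m₃ + 1) × Fin 4 → G,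
      (∀ x μ ν, finTorusPlaquette U x μ ν = 1) ↔ U ∈ Φ.range := by
    intro U
    constructor
    · intro hU
      obtain ⟨g, s, h⟩ := exists_gaugeTwist_of_flat U hU
      exact ⟨(g, s), by rw [hΦ]; exact h⟩
    · rintro ⟨⟨g, s⟩, rfl⟩ x μ ν
      rw [hΦ]
      exact flat_gaugeTwist g s x μ ν
  -- its kernel is the constants
  have hker : Nat.card Φ.ker = Nat.card G := by
    refine Nat.card_congr
      { toFun := fun p => p.1.1 (0, 0, 0, 0)
        invFun := fun a => ⟨(fun _ => a, 1), by
          rw [MonoidHom.mem_ker, hΦ]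
          funext l
          obtain ⟨x, μ⟩ := l
          fin_cases μ <;> simp⟩
        left_inv := by
          rintro ⟨⟨g, s⟩, hp⟩
          rw [MonoidHom.mem_ker, hΦ] at hp
          obtain ⟨hs, hg⟩ := gaugeTwist_eq_one g s fun x μ => congrFun hp (x, μ)
          subst hs
          ext x
          · exact (hg x).symm
          · rfl
        right_inv := fun a => rfl }
  -- first isomorphism theorem and bookkeeping
  have h1 := Subgroup.card_eq_card_quotient_mul_card_subgroup Φ.ker
  have h2 : Nat.card (((FinTorusSite (m₀ + 1) (m₁ + 1) (m₂ + 1) (m₃ + 1) → G) × (Fin 4 → G)) ⧸ Φ.ker) = Nat.card Φ.range :=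
    Nat.card_congr (QuotientGroup.quotientKerEquivRange Φ).toEquiv
  have h3 : Nat.card {U : FinTorusSite (m₀ + 1) (m₁ + 1) (m₂ + 1) (m₃ + 1) × Fin 4 → G //
      ∀ x μ ν, finTorusPlaquette U x μ ν = 1} = Nat.card Φ.range :=
    Nat.card_congr (Equiv.subtypeEquivRight hrange)
  have h4 : Nat.card ((FinTorusSite (m₀ + 1) (m₁ + 1) (m₂ + 1) (m₃ + 1) → G) × (Fin 4 → G)) =
      Nat.card G ^ (Nat.card (FinTorusSite (m₀ + 1) (m₁ + 1) (m₂ + 1) (m₃ + 1)) + 3) * Nat.card G := by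
    rw [Nat.card_prod, Nat.card_fun, Nat.card_fun]
    simp only [Nat.card_eq_fintype_card, Fintype.card_fin]
    ring
  have hpos : 0 < Nat.card G := Nat.card_pos
  have h5 : Nat.card Φ.range * Nat.card G =
      Nat.card G ^ (Nat.card (FinTorusSite (m₀ + 1) (m₁ + 1) (m₂ + 1) (m₃ + 1)) + 3) * Nat.card G := by
    rw [← h4, h1, h2, hker]
  rw [h3]
  exact Nat.eq_of_mul_eq_mul_right hpos h5

end Summit.QuantumFields.YangMills.Cruxes.IR.FreezingLimit
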